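import Summits.NavierStokesRegularity.NavierStokesRegularity.Theorems.ScenarioCensusBlochMeterKernel
import Summits.NavierStokesRegularity.NavierStokesRegularity.Theorems.ScenarioCensusRotationOrder
import HarnessLib

/-!
# BLOCH METER port, part 3/3: §C realisability control for the open coaxial cell (kinematics cannot decide `Row_A2blA`: `control_coaxial`); census KEYS

Re-homed for the scenario census (typer seat ns-census-typer-1 g10; the cells A2blN / A2blC / A2blU / A2blR are MEMBERS OF RECORD «DECIDED IN KERNEL IN FILES» of row A2 (ns-idea-2 g18 LINE g18-4:
critic idea-crit-3 g11 PASS 15:59:03Z; ref ns-census-ref g16 PRE-CHECK ✓ §21.22; lead label; OF RECORD 4/4 at census v1.135, KEY-NS #240), A2blA OPEN (typed); this port makes the decided cells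
TREE-decided): VERBATIM PORT of ns-idea-2 LINE g18-4 «bloch-meter», `pub/ideators/ns-idea-2/lines/bloch-meter/line-bloch-meter.lean` sha16 c4e2e5a09424cfd5 (743 l., lean check rc 0,
0 sorry), split for the 400-line rule into `ScenarioCensusBlochMeter` (model, §B, pencil) → `…BlochMeterKernel` (§K, §G) → `…BlochMeterControl` (§C + census KEYS).  Lean text VERBATIM in
namespace `…Theorems.ScenarioCensus.BlochMeter` (the line's `…Lines.BlochMeter` re-homed); port edits: the line's `local notation "E3"` is spelled as the reducible `abbrev E3` of every census
file; `rotZ_neg_rotZ` is the census rotation-order port's (`RotationOrder.rotZ_neg_rotZ`, BY NAME, gate lint dedup.landed); the three component simp-lemmas `e2_apply_zero/one/two` of the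
line's own `e2` (their TEXT coincides with `ForcedSymmetry.Negative.e2_c0/1/2`, a different constant) and `hasFDerivAt_coord` (twin of a Literature lemma outside this closure) are not
re-declared (inlined / unfolded at the use sites); `@[conjecture]` on the OPEN row `Row_A2blA`; one-line docstrings added where missing (gate lint).  Statements untouched.

No census VALUE is moved here (row A2 stays OPEN-WITH-LINE; the members become TREE-decided by name); (L′) is NOT proved; no summit statement is proved by this file. Lemmas that restate already-landed tree declarations are taken BY NAME (gate lint `dedup.landed`): `rotZ_neg_rotZ` = `RotationOrder.rotZ_neg_rotZ`.
-/

-- the summit and its single problem share the name `NavierStokesRegularity` (D-0017 nested layout)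
set_option linter.dupNamespace false

noncomputable section

open Set Function Filter Metric MeasureTheory InnerProductSpace
open scoped Topology RealInnerProductSpace
open Literature.Analysis Literature.Analysis.FluidPDE
open Summit.NavierStokesRegularity.NavierStokesRegularity.Theorems
open Summit.NavierStokesRegularity.NavierStokesRegularity.Theorems.ScenarioCensus

namespace Summit.NavierStokesRegularity.NavierStokesRegularity.Theorems.ScenarioCensus.BlochMeter

/-! ### §C  Realisability control for the open coaxial cell (kinematics cannot decide `Row_A2blA`) -/

section Control

/-- Vertical modulation `2 + cos (2π s)`: `1`-periodic, valued in `[1, 3]`. -/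
def cw (s : ℝ) : ℝ := 2 + Real.cos (2 * Real.pi * s)

/-- Positivity (`cw_pos`). -/
theorem cw_pos (s : ℝ) : 0 < cw s := by
  have := Real.neg_one_le_cos (2 * Real.pi * s); unfold cw; linarith

/-- An elementary bound (`cw_le`). -/
theorem cw_le (s : ℝ) : cw s ≤ 3 := by
  have := Real.cos_le_one (2 * Real.pi * s); unfold cw; linarith

/-- Auxiliary lemma of the line, stated and proved verbatim (`cw_zero`). -/
theorem cw_zero : cw 0 = 3 := by simp [cw]; norm_num

/-- Auxiliary lemma of the line, stated and proved verbatim (`cw_add_one`). -/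
theorem cw_add_one (s : ℝ) : cw (s + 1) = cw s := by
  unfold cw; rw [mul_add, mul_one, Real.cos_add_two_pi]

/-- THE CONTROL FIELD: a horizontally polarised wave train turning by `θ` per unit height, with a
`1`-periodic amplitude modulation, plus a vertical component decaying in the horizontal variables:
`polF θ y = ((2 + cos 2πy₂) cos θy₂, (2 + cos 2πy₂) sin θy₂, (1 + y₀² + y₁²)⁻¹)`. -/
def polF (θ : ℝ) (y : E3) : E3 :=
  (cw (y 2) * Real.cos (θ * y 2)) • EuclideanSpace.single 0 1 +
    (cw (y 2) * Real.sin (θ * y 2)) • EuclideanSpace.single 1 1 + (1 + y 0 ^ 2 + y 1 ^ 2)⁻¹ • e2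

/-- Component / evaluation formula (`polF_apply_zero`). -/
@[simp] theorem polF_apply_zero (θ : ℝ) (y : E3) : polF θ y 0 = cw (y 2) * Real.cos (θ * y 2) := by
  simp [polF, e2]

/-- Component / evaluation formula (`polF_apply_one`). -/
@[simp] theorem polF_apply_one (θ : ℝ) (y : E3) : polF θ y 1 = cw (y 2) * Real.sin (θ * y 2) := by
  simp [polF, e2]

/-- Component / evaluation formula (`polF_apply_two`). -/
@[simp] theorem polF_apply_two (θ : ℝ) (y : E3) : polF θ y 2 = (1 + y 0 ^ 2 + y 1 ^ 2)⁻¹ := by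
  simp [polF, e2]

/-- The control has the COAXIAL rotational Floquet twin: `polF θ (y + e₂) = rotZ θ (polF θ y)`. -/
theorem polF_twist (θ : ℝ) (y : E3) : polF θ (y + e2) = rotZ θ (polF θ y) := by
  have h2 : (y + e2) 2 = y 2 + 1 := by simp [e2]
  have h0 : (y + e2) 0 = y 0 := by simp [e2]
  have h1 : (y + e2) 1 = y 1 := by simp [e2]
  ext i
  fin_cases i
  · simp only [Fin.zero_eta, polF_apply_zero, h2, cw_add_one, rotZ_apply_zero, polF_apply_one, mul_add,
      mul_one, Real.cos_add]
    ring
  · simp only [Fin.mk_one, polF_apply_one, h2, cw_add_one, rotZ_apply_one, polF_apply_zero, mul_add, mul_one,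
      Real.sin_add]
    ring
  · simp only [Fin.reduceFinMk, polF_apply_two, h0, h1, rotZ_apply_two]

/-- The control is bounded: `‖polF θ y‖ ≤ 4`. -/
theorem norm_polF_le (θ : ℝ) (y : E3) : ‖polF θ y‖ ≤ 4 := by
  have hq : 1 ≤ 1 + y 0 ^ 2 + y 1 ^ 2 := by nlinarith [sq_nonneg (y 0), sq_nonneg (y 1)]
  have hg0 : 0 < (1 + y 0 ^ 2 + y 1 ^ 2)⁻¹ := inv_pos.2 (by linarith)
  have hg1 : (1 + y 0 ^ 2 + y 1 ^ 2)⁻¹ ≤ 1 := inv_le_one_of_one_le₀ hq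
  have hcs := Real.cos_sq_add_sin_sq (θ * y 2)
  have hS : ‖polF θ y 0‖ ^ 2 + ‖polF θ y 1‖ ^ 2 + ‖polF θ y 2‖ ^ 2 ≤ 16 := by
    simp only [polF_apply_zero, polF_apply_one, polF_apply_two, Real.norm_eq_abs, sq_abs]
    have hc : (cw (y 2) * Real.cos (θ * y 2)) ^ 2 + (cw (y 2) * Real.sin (θ * y 2)) ^ 2 = cw (y 2) ^ 2 := by
      linear_combination (cw (y 2)) ^ 2 * hcs
    rw [hc]
    nlinarith [cw_pos (y 2), cw_le (y 2)]
  rw [EuclideanSpace.norm_eq, Fin.sum_univ_three]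
  calc Real.sqrt (‖polF θ y 0‖ ^ 2 + ‖polF θ y 1‖ ^ 2 + ‖polF θ y 2‖ ^ 2) ≤ Real.sqrt 16 :=
        Real.sqrt_le_sqrt hS
    _ = 4 := by rw [show (16 : ℝ) = 4 ^ 2 by norm_num]; exact Real.sqrt_sq (by norm_num)

-- `hasFDerivAt_coord`: a statement-twin of the landed `Literature.Analysis.FluidPDE.Wei2016.hasFDerivAt_coord` (module outside this file's import closure); not re-declared — the three instances are stated inline in `isDivFree_polF`.

/-- The control is divergence free: each component is independent of its own coordinate. -/
theorem isDivFree_polF (θ : ℝ) : VectorCalculus.IsDivFree (polF θ) := fun y => by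
  have h0 : HasFDerivAt (fun z : E3 => (z 0 : ℝ)) (EuclideanSpace.proj (𝕜 := ℝ) 0 : E3 →L[ℝ] ℝ) y :=
    (EuclideanSpace.proj (𝕜 := ℝ) 0 : E3 →L[ℝ] ℝ).hasFDerivAt
  have h1 : HasFDerivAt (fun z : E3 => (z 1 : ℝ)) (EuclideanSpace.proj (𝕜 := ℝ) 1 : E3 →L[ℝ] ℝ) y :=
    (EuclideanSpace.proj (𝕜 := ℝ) 1 : E3 →L[ℝ] ℝ).hasFDerivAt
  have h2 : HasFDerivAt (fun z : E3 => (z 2 : ℝ)) (EuclideanSpace.proj (𝕜 := ℝ) 2 : E3 →L[ℝ] ℝ) y :=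
    (EuclideanSpace.proj (𝕜 := ℝ) 2 : E3 →L[ℝ] ℝ).hasFDerivAt
  have hφ₀ : Differentiable ℝ (fun s : ℝ => cw s * Real.cos (θ * s)) := by unfold cw; fun_prop
  have hφ₁ : Differentiable ℝ (fun s : ℝ => cw s * Real.sin (θ * s)) := by unfold cw; fun_prop
  have hA := (((hφ₀ (y 2)).hasDerivAt).comp_hasFDerivAt y h2).smul_const (EuclideanSpace.single (0 : Fin 3) (1 : ℝ))
  have hB := (((hφ₁ (y 2)).hasDerivAt).comp_hasFDerivAt y h2).smul_const (EuclideanSpace.single (1 : Fin 3) (1 : ℝ))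
  have hq : HasFDerivAt (fun y : E3 => 1 + y 0 ^ 2 + y 1 ^ 2) _ y :=
    ((hasFDerivAt_const (1 : ℝ) y).add (h0.pow 2)).add (h1.pow 2)
  have hne : 1 + y 0 ^ 2 + y 1 ^ 2 ≠ 0 := by nlinarith [sq_nonneg (y 0), sq_nonneg (y 1)]
  have hCq := ((hasDerivAt_inv hne).comp_hasFDerivAt y hq).smul_const e2
  have hF : HasFDerivAt (polF θ) _ y := (hA.add hB).add hCq
  rw [divergence_eq_sum_inner_fderiv (EuclideanSpace.basisFun (Fin 3) ℝ), hF.fderiv]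
  simp [Fin.sum_univ_three, EuclideanSpace.inner_single_left, e2]

/-- The control has NO translation symmetry when `θ / 2π` is irrational (so it is outside census A13):
`polF θ (· + v) = polF θ` forces `v = 0`. -/
theorem polF_translate {θ : ℝ} (hθ : Irrational (θ / (2 * Real.pi))) {v : E3}
    (h : ∀ y, polF θ (y + v) = polF θ y) : v = 0 := by
  have hv := h 0
  rw [zero_add] at hv
  have e0 := congrArg (fun w : E3 => w 0) hv
  have e1 := congrArg (fun w : E3 => w 1) hv
  have e2' := congrArg (fun w : E3 => w 2) hv
  simp only [polF_apply_zero, polF_apply_one, polF_apply_two, PiLp.zero_apply, mul_zero, Real.cos_zero,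
    Real.sin_zero, cw_zero, mul_one] at e0 e1 e2'
  -- third component: `(1 + v₀² + v₁²)⁻¹ = 1`, so `v₀ = v₁ = 0`
  have hq : 1 + v 0 ^ 2 + v 1 ^ 2 = 1 := by
    have : (1 + v 0 ^ 2 + v 1 ^ 2)⁻¹ = 1 := by simpa using e2'
    exact inv_eq_one.1 this
  have hv0 : v 0 = 0 := by nlinarith [sq_nonneg (v 0), sq_nonneg (v 1)]
  have hv1 : v 1 = 0 := by nlinarith [sq_nonneg (v 0), sq_nonneg (v 1)]
  -- horizontal components: `cw v₂ = 3`, so `v₂ ∈ ℤ`, then `cos (θ v₂) = 1`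
  have hcs := Real.cos_sq_add_sin_sq (θ * v 2)
  have hcw : cw (v 2) = 3 := by
    have h9 : cw (v 2) ^ 2 = 9 := by nlinarith [e0, e1, hcs]
    nlinarith [cw_pos (v 2)]
  have hcos1 : Real.cos (2 * Real.pi * v 2) = 1 := by unfold cw at hcw; linarith
  obtain ⟨n, hn⟩ := (Real.cos_eq_one_iff _).1 hcos1
  have hv2n : v 2 = n := by
    have := mul_right_cancel₀ (by positivity : (2 * Real.pi) ≠ 0) (hn.trans (mul_comm _ _))
    exact this.symm
  have hcos2 : Real.cos (θ * v 2) = 1 := by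
    rw [hcw] at e0; linarith
  obtain ⟨m, hm⟩ := (Real.cos_eq_one_iff _).1 hcos2
  have hv2 : v 2 = 0 := by
    by_contra hne
    have hn0 : (n : ℝ) ≠ 0 := hv2n ▸ hne
    have hn0' : n ≠ 0 := fun h => hn0 (by simp [h])
    have hrat : θ / (2 * Real.pi) = m / n := by
      rw [div_eq_div_iff (by positivity) hn0, ← hv2n]
      linarith [hm]
    exact (irrational_iff_ne_rational _).1 hθ m n hn0' hrat
  ext i
  fin_cases i
  · simpa using hv0
  · simpa using hv1
  · simpa using hv2

/-- REALISABILITY OF THE COAXIAL CELL: for `θ / 2π` irrational there is a bounded, divergence-free, nowhere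
trivially periodic field with the coaxial twin `F (y + e₂) = rotZ θ (F y)` — the exact kinematic shape of
`Row_A2blA` (with `D = 1`, `a = e₂`, `U = univ`).  Hence no ONE-SLICE KINEMATIC law decides that cell: only the
class (the dynamics) can.  `polF θ` is NOT claimed to be a slice of a class element. -/
theorem control_coaxial {θ : ℝ} (hθ : Irrational (θ / (2 * Real.pi))) :
    ∃ F : E3 → E3, VectorCalculus.IsDivFree F ∧ (∀ y, ‖F y‖ ≤ 4) ∧ (∀ y, F (y + e2) = rotZ θ (F y)) ∧
      F ≠ 0 ∧ ∀ v : E3, (∀ y, F (y + v) = F y) → v = 0 :=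
  ⟨polF θ, isDivFree_polF θ, norm_polF_le θ, polF_twist θ, fun h0 => by
    have := congrArg (fun F : E3 → E3 => F 0 2) h0
    simp at this, fun _ hv => polF_translate hθ hv⟩

end Control

end Summit.NavierStokesRegularity.NavierStokesRegularity.Theorems.ScenarioCensus.BlochMeter

namespace Summit.NavierStokesRegularity.NavierStokesRegularity.Theorems.ScenarioCensus

/-! ## Census KEYS (ns `…Theorems.ScenarioCensus`): instrument BLOCH METER (block A2) — TREE-decided cells A2blN / A2blC / A2blU / A2blR, OPEN row A2blA -/

/-- **Cell A2blN** (a Floquet twin of one slice on a pocket, NILPOTENT / parabolic type ⇒ `u ≡ 0`): `:= BlochMeter.Row_A2blN`. DECIDED. -/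
def Row_A2blN : Prop := BlochMeter.Row_A2blN
/-- A2blN is EXCLUDED (decided in the tree): `BlochMeter.row_A2blN`. -/
theorem row_A2blN_excluded : Row_A2blN := BlochMeter.row_A2blN

/-- **Cell A2blC**: `:= BlochMeter.Row_A2blC`. DECIDED. -/
def Row_A2blC : Prop := BlochMeter.Row_A2blC
/-- A2blC is EXCLUDED (decided in the tree): `BlochMeter.row_A2blC`. -/
theorem row_A2blC_excluded : Row_A2blC := BlochMeter.row_A2blC

/-- **Cell A2blU**: `:= BlochMeter.Row_A2blU`. DECIDED. -/
def Row_A2blU : Prop := BlochMeter.Row_A2blU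
/-- A2blU is EXCLUDED (decided in the tree): `BlochMeter.row_A2blU`. -/
theorem row_A2blU_excluded : Row_A2blU := BlochMeter.row_A2blU

/-- **Cell A2blR** (a TRANSVERSAL ROTATIONAL Floquet twin of order ≥ 3 on a pocket of one slice ⇒ `u ≡ 0`): `:= BlochMeter.Row_A2blR`. DECIDED. -/
def Row_A2blR : Prop := BlochMeter.Row_A2blR
/-- A2blR is EXCLUDED (decided in the tree): `BlochMeter.row_A2blR`. -/
theorem row_A2blR_excluded : Row_A2blR := BlochMeter.row_A2blR

/-- **Row A2blA** (COAXIAL rotational twin) — typed only; kinematically nonempty (`BlochMeter.control_coaxial`): `:= BlochMeter.Row_A2blA`. OPEN. -/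
@[conjecture] def Row_A2blA : Prop := BlochMeter.Row_A2blA

end Summit.NavierStokesRegularity.NavierStokesRegularity.Theorems.ScenarioCensus

end
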